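import Literature.MathematicalPhysics.QuantumLattice.HubbardTorusCharges
import HarnessLib

/-!
# Coordinate slabs, cyclic intervals and lattice translations for the charge-transport index

Generic geometric layer for the Lieb–Schultz–Mattis case of Bachmann–Bols–De Roeck–Fraas,
*A many-body index for quantum charge transport*, Comm. Math. Phys. **375** (2019) 1249 (BBDF),
§2.1.1, §2.3.2 ("Geometry": only a codimension-one direction with two well-separated boundary
components is used) and §3.2, for the Hubbard Hamiltonian `hamiltonianWith G t U μ` on an
ARBITRARY finite graph `G` on a linearly ordered site type `Λ` equipped with

* a **coordinate function** `coord : Λ → ℤ/L` with `IsCoordFn coord G` (adjacent sites have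
  equal or consecutive coordinates) — for the torus `ℤ_L^d` this is `coordZ i₀`
  (`HubbardTorusCharges.coordZ_rel_of_adj`);
* a **unit translation** `f : Λ ≃ Λ` with `coord ∘ f = coord + 1` (hypothesis `hf`) — for
  the torus, `siteShift i₀` (`coordZ_siteShift`).

All analysis (operator norms) downstream is done at this generality and the concrete torus enters
only in the final, norm-free statement; this sidesteps the two `DecidableEq (Orb (FermionTorus d L))`
instance paths noted in `HubbardLSMFillingProofs`/`HubbardTorusCharges`. Contents (all proved):

* `cslab coord S` (slabs over coordinate sets; BBDF's hyperplanes, intervals, half-torus, strips),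
  `clevel` (the `x₁`-level function `min_{y∈Y} circDist(coord ·, coord y)`, `1`-Lipschitz along
  bonds: input of the fermionic Lieb–Robinson bound);
* `zrange a n = {a, …, a+n-1} ⊆ ℤ/L` (cyclic intervals): splitting, shifting, disjointness,
  cardinality, membership tests (`natCast_eq_natCast_iff_of_lt`);
* **the terms crossing the boundary of the half-space slab `[0,h)` lie in the two windows
  `{-1,0}` and `{h-1,h}`** (`crossing_zrange_subset`; BBDF §3.2: charge leaves `Γ` only through
  `∂_-` and `∂_+`), the windows being disjoint (`disjoint_windows`);
* translations: `map_cslab`, `relabelOp_conj_setCharge_cslab` (`V Q_{slab S} Vᴴ = Q_{slab(S+1)}`),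
  covariance of the even CAR algebras (`relabel_mem_carEvenSubalgebra`,
  `relabelOp_conj_mem_carEvenSubalgebra_cslab`), the unique gapped ground state is a translation
  eigenvector (`exists_relabelOp_mulVec_eq_smul`) and its expectations are translation invariant
  both ways (`expect_relabelOp_conj`).

## References

* S. Bachmann, A. Bols, W. De Roeck, M. Fraas, Comm. Math. Phys. **375** (2019) 1249, §2.1.1, §2.3.2,
  §3.2. [BachmannEtAl2019]
* The tree: `HubbardTorusCharges` (`circDist`, `setCharge`, `crossing`, `relabel_mapEquiv_setCharge`),
  `FermionRelabelling` (`relabel`, `relabel_creation`, `relabel_annihilation`),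
  `FermionTraceFactorization` (`carEvenSubalgebra`, `letterOp`), `HubbardLSMFillingProofs`
  (`relabelOp`, `HasSpectralGap.exists_mulVec_eq_smul`), `ApproximateEigenvectorLemmas`.
-/

noncomputable section

namespace Literature.MathematicalPhysics.QuantumLattice

open Matrix Complex Finset HubbardWave0
open scoped Matrix.Norms.L2Operator ComplexOrder

section CoordSlabs

variable {Λ : Type*} [Fintype Λ] {L : ℕ} (coord : Λ → ZMod L)

/-- A **coordinate function** for the graph `G`: adjacent sites have equal or consecutive values in
`ℤ/L` (the `x₁`-coordinate of the torus `ℤ_L^d`; BBDF §2.3.2 "Geometry": only such a structure is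
used). [cite: BachmannEtAl2019, §2.3.2] -/
def IsCoordFn (G : SimpleGraph Λ) : Prop :=
  ∀ u v : Λ, G.Adj u v → coord u = coord v ∨ coord v = coord u + 1 ∨ coord u = coord v + 1

/-- The slab `{x : coord x ∈ S}` over a set of coordinate values. [cite: BachmannEtAl2019, §2.1.1] -/
def cslab (S : Finset (ZMod L)) : Finset Λ := Finset.univ.filter fun x => coord x ∈ S

/-- Membership in a slab. [folklore] -/
@[simp] theorem mem_cslab {S : Finset (ZMod L)} {x : Λ} : x ∈ cslab coord S ↔ coord x ∈ S := by
  simp [cslab]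

/-- Slabs over disjoint coordinate sets are disjoint. [folklore] -/
theorem disjoint_cslab {S T : Finset (ZMod L)} (h : Disjoint S T) : Disjoint (cslab coord S) (cslab coord T) := by
  rw [Finset.disjoint_left]
  intro x hx hx'
  rw [mem_cslab] at hx hx'
  exact Finset.disjoint_left.1 h hx hx'

/-- Slabs are monotone. [folklore] -/
theorem cslab_mono {S T : Finset (ZMod L)} (h : S ⊆ T) : cslab coord S ⊆ cslab coord T := fun x hx => by
  rw [mem_cslab] at hx ⊢; exact h hx

/-- Slabs are additive. [folklore] -/
theorem cslab_union [DecidableEq Λ] (S T : Finset (ZMod L)) : cslab coord (S ∪ T) = cslab coord S ∪ cslab coord T := by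
  ext x; simp [mem_cslab]

/-- The `x₁`-level function of a set of sites: `δ_Y(z) = min_{y ∈ Y} circDist(coord z, coord y)`.
[folklore] -/
def clevel (Y : Finset Λ) (hY : Y.Nonempty) (z : Λ) : ℕ :=
  (Y.image coord).inf' (hY.image _) fun b => circDist (coord z) b

omit [Fintype Λ] in
/-- The level function vanishes on `Y`. [folklore] -/
theorem clevel_eq_zero {Y : Finset Λ} (hY : Y.Nonempty) {y : Λ} (hy : y ∈ Y) : clevel coord Y hY y = 0 := by
  refine Nat.eq_zero_of_le_zero ((Finset.inf'_le _ (Finset.mem_image_of_mem _ hy)).trans ?_)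
  simp

omit [Fintype Λ] in
/-- The level function is `1`-Lipschitz along bonds of a graph with a coordinate function. [folklore] -/
theorem clevel_le_of_adj [NeZero L] {G : SimpleGraph Λ} (hc : IsCoordFn coord G) {Y : Finset Λ} (hY : Y.Nonempty)
    {u v : Λ} (h : G.Adj u v) : clevel coord Y hY u ≤ clevel coord Y hY v + 1 := by
  unfold clevel
  obtain ⟨b, hb, hmin⟩ := Finset.exists_mem_eq_inf' (hY.image coord) (fun b => circDist (coord v) b)
  rw [hmin]
  refine (Finset.inf'_le _ hb).trans ?_
  rcases hc u v h with e | e | e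
  · rw [e]; exact Nat.le_succ _
  · rw [e]; exact circDist_le_circDist_add_one _ _
  · rw [e]; exact circDist_add_one_le _ _

omit [Fintype Λ] in
/-- The level is at least the `x₁`-distance `D` of the two site sets. [folklore] -/
theorem le_clevel {X Y : Finset Λ} (hY : Y.Nonempty) {D : ℕ}
    (hD : ∀ x ∈ X, ∀ y ∈ Y, D ≤ circDist (coord x) (coord y)) {x : Λ} (hx : x ∈ X) :
    D ≤ clevel coord Y hY x := by
  refine Finset.le_inf' _ _ fun b hb => ?_
  obtain ⟨y, hy, rfl⟩ := Finset.mem_image.1 hb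
  exact hD x hx y hy

end CoordSlabs

section ZRange

variable {L : ℕ}

/-- The cyclic interval `{a, a+1, …, a+n-1} ⊆ ℤ/L` (BBDF's `[a, b] = {a ≤ x₁ ≤ b}`).
[cite: BachmannEtAl2019, §3.2] -/
def zrange (a n : ℕ) : Finset (ZMod L) := (Finset.range n).image fun k => ((a + k : ℕ) : ZMod L)

/-- Membership in a cyclic interval. [folklore] -/
theorem mem_zrange {a n : ℕ} {x : ZMod L} : x ∈ zrange a n ↔ ∃ k, k < n ∧ x = ((a + k : ℕ) : ZMod L) := by
  simp only [zrange, Finset.mem_image, Finset.mem_range]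
  constructor
  · rintro ⟨k, hk, rfl⟩; exact ⟨k, hk, rfl⟩
  · rintro ⟨k, hk, rfl⟩; exact ⟨k, hk, rfl⟩

/-- `a + k ∈ zrange a n` for `k < n`. [folklore] -/
theorem natCast_add_mem_zrange {a n k : ℕ} (hk : k < n) : ((a + k : ℕ) : ZMod L) ∈ zrange a n :=
  mem_zrange.2 ⟨k, hk, rfl⟩

/-- The empty interval. [folklore] -/
@[simp] theorem zrange_zero (a : ℕ) : (zrange a 0 : Finset (ZMod L)) = ∅ := by simp [zrange]

/-- Splitting a cyclic interval: `[a, a+m+n) = [a, a+m) ∪ [a+m, a+m+n)`. [folklore] -/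
theorem zrange_add (a m n : ℕ) : (zrange a (m + n) : Finset (ZMod L)) = zrange a m ∪ zrange (a + m) n := by
  ext x
  simp only [mem_zrange, Finset.mem_union]
  constructor
  · rintro ⟨k, hk, rfl⟩
    by_cases hkm : k < m
    · exact Or.inl ⟨k, hkm, rfl⟩
    · refine Or.inr ⟨k - m, by omega, ?_⟩
      congr 1; omega
  · rintro (⟨k, hk, rfl⟩ | ⟨k, hk, rfl⟩)
    · exact ⟨k, by omega, rfl⟩
    · exact ⟨m + k, by omega, by congr 1; omega⟩

/-- The one-point interval. [folklore] -/
theorem zrange_one (a : ℕ) : (zrange a 1 : Finset (ZMod L)) = {((a : ℕ) : ZMod L)} := by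
  ext x; simp [mem_zrange]

/-- Shifting a cyclic interval by one. [folklore] -/
theorem image_add_one_zrange (a n : ℕ) :
    (zrange a n : Finset (ZMod L)).image (fun x => x + 1) = zrange (a + 1) n := by
  ext x
  simp only [Finset.mem_image, mem_zrange]
  constructor
  · rintro ⟨y, ⟨k, hk, rfl⟩, rfl⟩
    exact ⟨k, hk, by push_cast; ring⟩
  · rintro ⟨k, hk, rfl⟩
    exact ⟨((a + k : ℕ) : ZMod L), ⟨k, hk, rfl⟩, by push_cast; ring⟩

/-- Two naturals closer than `L` apart are congruent mod `L` only if equal. [folklore] -/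
theorem natCast_eq_natCast_iff_of_lt {p q : ℕ} (h : p < q + L) (h' : q < p + L) :
    ((p : ℕ) : ZMod L) = ((q : ℕ) : ZMod L) ↔ p = q := by
  constructor
  · intro hpq
    rw [ZMod.natCast_eq_natCast_iff] at hpq
    rcases le_total p q with hle | hle
    · have hd := (Nat.modEq_iff_dvd' hle).1 hpq
      have : q - p = 0 := Nat.eq_zero_of_dvd_of_lt hd (by omega)
      omega
    · have hd := (Nat.modEq_iff_dvd' hle).1 hpq.symm
      have : p - q = 0 := Nat.eq_zero_of_dvd_of_lt hd (by omega)
      omega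
  · rintro rfl; rfl

/-- Consecutive cyclic intervals of total length `≤ L` are disjoint. [folklore] -/
theorem disjoint_zrange {a m n : ℕ} (h : m + n ≤ L) : Disjoint (zrange a m : Finset (ZMod L)) (zrange (a + m) n) := by
  rw [Finset.disjoint_left]
  rintro x hx hx'
  obtain ⟨k, hk, rfl⟩ := mem_zrange.1 hx
  obtain ⟨k', hk', he⟩ := mem_zrange.1 hx'
  rw [natCast_eq_natCast_iff_of_lt (by omega) (by omega)] at he
  omega

/-- Cyclic intervals `[a, a+m)` and `[b, b+n)` with `a + m ≤ b` and `b + n ≤ a + L` are disjoint.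
[folklore] -/
theorem disjoint_zrange_of_le {a m b n : ℕ} (h1 : a + m ≤ b) (h2 : b + n ≤ a + L) :
    Disjoint (zrange a m : Finset (ZMod L)) (zrange b n) := by
  rw [Finset.disjoint_left]
  rintro x hx hx'
  obtain ⟨k, hk, rfl⟩ := mem_zrange.1 hx
  obtain ⟨k', hk', he⟩ := mem_zrange.1 hx'
  rw [natCast_eq_natCast_iff_of_lt (by omega) (by omega)] at he
  omega

/-- The cardinality of a cyclic interval of length `n ≤ L` is `n`. [folklore] -/
theorem card_zrange {a n : ℕ} (h : n ≤ L) : (zrange a n : Finset (ZMod L)).card = n := by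
  rw [zrange, Finset.card_image_of_injOn, Finset.card_range]
  intro k hk k' hk' he
  simp only [Finset.coe_range, Set.mem_Iio] at hk hk'
  have := (natCast_eq_natCast_iff_of_lt (L := L) (p := a + k) (q := a + k') (by omega) (by omega)).1 he
  omega

/-- Membership of `a + k` (`k < L`) in `[a, a+n)`: iff `k < n`. [folklore] -/
theorem natCast_add_mem_zrange_iff {a n k : ℕ} (hn : n ≤ L) (hk : k < L) :
    ((a + k : ℕ) : ZMod L) ∈ zrange a n ↔ k < n := by
  rw [mem_zrange]
  constructor
  · rintro ⟨k', hk', he⟩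
    rw [natCast_eq_natCast_iff_of_lt (by omega) (by omega)] at he
    omega
  · intro h; exact ⟨k, h, rfl⟩

end ZRange

/-! ### The terms crossing the boundary of a half-space slab sit in two windows -/

section Crossing

variable {Λ : Type*} [LinearOrder Λ] [Fintype Λ] (G : SimpleGraph Λ) [DecidableRel G.Adj]
variable {L : ℕ} [NeZero L] (coord : Λ → ZMod L)

/-- On-site terms never cross a boundary. [folklore] -/
theorem inr_not_mem_crossing (X : Finset Λ) (x : Λ) : (Sum.inr x : HubbardIdx G) ∉ crossing G X := by
  rw [mem_crossing, hubbardTermSupp]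
  rintro ⟨h1, h2⟩
  by_cases hx : x ∈ X
  · exact h1 (Finset.singleton_subset_iff.2 hx)
  · exact h2 (Finset.disjoint_singleton_left.2 hx)

/-- `(L - 1 : ℕ) = -1` in `ℤ/L`. [folklore] -/
theorem natCast_pred_eq_neg_one : ((L - 1 : ℕ) : ZMod L) = -1 := by
  have hL : 1 ≤ L := NeZero.pos L
  have h : ((L - 1 : ℕ) : ZMod L) + 1 = 0 := by
    have h1 : ((L - 1 + 1 : ℕ) : ZMod L) = 0 := by rw [Nat.sub_add_cancel hL, ZMod.natCast_self]
    rw [← h1]; push_cast; ring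
  linear_combination h

/-- **The bonds crossing the boundary of the half-space slab `[0, h)` lie in the two windows
`{-1, 0}` and `{h-1, h}`** (BBDF §3.2: `UᶜQ_ΓU - Q_Γ = -Q_{[0]} + Q_{[L/2]}`, i.e. charge leaves `Γ`
only across its two boundary hyperplanes). Requires `2 ≤ h` and `h + 2 ≤ L`. [cite: BachmannEtAl2019, §3.2] -/
theorem crossing_zrange_subset (hc : IsCoordFn coord G) {h : ℕ} (h2 : 2 ≤ h) (hL : h + 2 ≤ L) :
    ∀ Z ∈ crossing G (cslab coord (zrange 0 h)),
      hubbardTermSupp G Z ⊆ cslab coord (zrange (L - 1) 2) ∨ hubbardTermSupp G Z ⊆ cslab coord (zrange (h - 1) 2) := by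
  intro Z hZ
  -- membership tests in the three intervals
  have memΓ : ∀ k : ℕ, k < L → (((k : ℕ) : ZMod L) ∈ zrange 0 h ↔ k < h) := fun k hk => by
    have := natCast_add_mem_zrange_iff (L := L) (a := 0) (n := h) (k := k) (by omega) hk
    rwa [zero_add] at this
  have memPp : ∀ j : ℕ, j < 2 → (((h - 1 + j : ℕ) : ZMod L)) ∈ zrange (h - 1) 2 := fun j hj =>
    natCast_add_mem_zrange hj
  have memPm : ∀ j : ℕ, j < 2 → (((L - 1 + j : ℕ) : ZMod L)) ∈ zrange (L - 1) 2 := fun j hj =>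
    natCast_add_mem_zrange hj
  have h0Pm : (0 : ZMod L) ∈ zrange (L - 1) 2 := by
    have := memPm 1 one_lt_two
    rwa [show L - 1 + 1 = L by omega, ZMod.natCast_self] at this
  have hm1Pm : (-1 : ZMod L) ∈ zrange (L - 1) 2 := by
    have := memPm 0 two_pos
    rwa [add_zero, natCast_pred_eq_neg_one] at this
  cases Z with
  | inr x => exact absurd hZ (inr_not_mem_crossing G _ x)
  | inl p =>
    obtain ⟨⟨x, y⟩, hxy⟩ := p
    rw [mem_crossing] at hZ
    simp only [hubbardTermSupp] at hZ ⊢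
    obtain ⟨hnsub, hndisj⟩ := hZ
    -- exactly one endpoint lies in the slab
    have key : ∀ u v : Λ, G.Adj u v → u ∈ cslab coord (zrange 0 h) → v ∉ cslab coord (zrange 0 h) →
        ({u, v} : Finset Λ) ⊆ cslab coord (zrange (L - 1) 2) ∨ ({u, v} : Finset Λ) ⊆ cslab coord (zrange (h - 1) 2) := by
      intro u v huv hu hv
      rw [mem_cslab] at hu hv
      obtain ⟨k, hk, hku⟩ := mem_zrange.1 hu
      rw [zero_add] at hku
      rcases hc u v huv with e | e | e
      · exact absurd (e ▸ hu) hv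
      · -- `coord v = k + 1`, so `k = h - 1`
        have hkv : coord v = ((k + 1 : ℕ) : ZMod L) := by rw [e, hku]; push_cast; ring
        have hk1 : ¬ (k + 1 < h) := fun hlt => hv (by rw [hkv]; exact (memΓ (k + 1) (by omega)).2 hlt)
        have hkeq : k = h - 1 := by omega
        right
        intro w hw
        rw [Finset.mem_insert, Finset.mem_singleton] at hw
        rw [mem_cslab]
        rcases hw with rfl | rfl
        · rw [hku, hkeq]; have := memPp 0 two_pos; rwa [add_zero] at this
        · rw [hkv, hkeq, show h - 1 + 1 = h - 1 + 1 from rfl]; exact memPp 1 one_lt_two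
      · -- `coord u = coord v + 1`, so `k = 0` and `coord v = -1`
        have hkv : coord v = ((k : ℕ) : ZMod L) - 1 := by rw [← hku, e]; ring
        have hk0 : k = 0 := by
          by_contra hk0
          apply hv
          rw [hkv, show ((k : ℕ) : ZMod L) - 1 = ((k - 1 : ℕ) : ZMod L) by
            rw [Nat.cast_sub (by omega)]; push_cast; ring]
          exact (memΓ (k - 1) (by omega)).2 (by omega)
        left
        intro w hw
        rw [Finset.mem_insert, Finset.mem_singleton] at hw
        rw [mem_cslab]
        rcases hw with rfl | rfl
        · rw [hku, hk0, Nat.cast_zero]; exact h0Pm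
        · rw [hkv, hk0, Nat.cast_zero, zero_sub]; exact hm1Pm
    by_cases hx : x ∈ cslab coord (zrange 0 h)
    · have hy : y ∉ cslab coord (zrange 0 h) := fun hy =>
        hnsub (Finset.insert_subset_iff.2 ⟨hx, Finset.singleton_subset_iff.2 hy⟩)
      exact key x y hxy hx hy
    · have hy : y ∈ cslab coord (zrange 0 h) := by
        by_contra hy
        exact hndisj (Finset.disjoint_insert_left.2 ⟨hx, Finset.disjoint_singleton_left.2 hy⟩)
      have := key y x (G.adj_symm hxy) hy hx
      rwa [Finset.pair_comm] at this

omit [LinearOrder Λ] [Fintype Λ] [DecidableRel G.Adj] [NeZero L] in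
/-- The two windows are disjoint (`2 ≤ h`, `h + 2 ≤ L`). [folklore] -/
theorem disjoint_windows {h : ℕ} (h2 : 2 ≤ h) (hL : h + 2 ≤ L) :
    Disjoint (zrange (L - 1) 2 : Finset (ZMod L)) (zrange (h - 1) 2) :=
  (disjoint_zrange_of_le (a := h - 1) (m := 2) (b := L - 1) (n := 2) (by omega) (by omega)).symm

end Crossing

/-! ### Lattice translations raising the coordinate by one -/

section Translation

variable {Λ : Type*} [LinearOrder Λ] [Fintype Λ] {L : ℕ} (coord : Λ → ZMod L) (f : Λ ≃ Λ)

variable {coord f}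

omit [LinearOrder Λ] in
/-- A coordinate shift maps the slab over `S` onto the slab over `S + 1`. [folklore] -/
theorem map_cslab (hf : ∀ x : Λ, coord (f x) = coord x + 1) (S : Finset (ZMod L)) :
    (cslab coord S).map f.toEmbedding = cslab coord (S.image fun a => a + 1) := by
  ext y
  simp only [Finset.mem_map_equiv, Finset.mem_image, mem_cslab]
  have h2 : coord y = coord (f.symm y) + 1 := by
    have := hf (f.symm y)
    rwa [Equiv.apply_symm_apply] at this
  constructor
  · intro hy
    exact ⟨coord (f.symm y), hy, h2.symm⟩
  · rintro ⟨a, ha, hay⟩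
    have : coord (f.symm y) = a := by
      have e := congrArg (fun z => z - 1) h2
      simp only [add_sub_cancel_right] at e
      rw [← e, ← hay, add_sub_cancel_right]
    rwa [this]

/-- **The translation unitary shifts the slab charges**: `V Q^σ_{slab S} Vᴴ = Q^σ_{slab (S+1)}` for
`V = Γ_{Orb.mapEquiv f}`. [folklore] -/
theorem relabelOp_conj_setCharge_cslab (hf : ∀ x : Λ, coord (f x) = coord x + 1) (σ : Fin 2) (S : Finset (ZMod L)) :
    relabelOp (Orb.mapEquiv f) * setCharge σ (cslab coord S) * (relabelOp (Orb.mapEquiv f))ᴴ =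
      setCharge σ (cslab coord (S.image fun a => a + 1)) := by
  rw [← relabel_eq_relabelOp_conj, relabel_mapEquiv_setCharge, map_cslab hf]

/-- Relabelling a Jordan–Wigner letter. [folklore] -/
theorem relabel_letterOp {ι ι' : Type*} [LinearOrder ι] [LinearOrder ι'] [Fintype ι] [Fintype ι']
    (e : ι ≃ ι') (l : JWLetter ι) : relabel e (letterOp l) = letterOp (e l.1, l.2) := by
  obtain ⟨i, b⟩ := l
  cases b
  · simp [letterOp, relabel_annihilation]
  · simp [letterOp, relabel_creation]

/-- **The even CAR algebras are covariant under relabelling**: `Γ_e 𝔄⁺(S) Γ_e⁻¹ ⊆ 𝔄⁺(e(S))`.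
[folklore] -/
theorem relabel_mem_carEvenSubalgebra {ι ι' : Type*} [LinearOrder ι] [LinearOrder ι'] [Fintype ι] [Fintype ι']
    (e : ι ≃ ι') {S : Finset ι} {A : Matrix (Finset ι) (Finset ι) ℂ} (hA : A ∈ carEvenSubalgebra S) :
    relabel e A ∈ carEvenSubalgebra (S.map e.toEmbedding) := by
  have hmap : (carEvenSubalgebra S).map (relabel e).toAlgHom ≤ carEvenSubalgebra (S.map e.toEmbedding) := by
    rw [carEvenSubalgebra, AlgHom.map_adjoin]
    refine Algebra.adjoin_mono ?_
    rintro _ ⟨M, ⟨l, l', hl, hl', rfl⟩, rfl⟩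
    refine ⟨(e l.1, l.2), (e l'.1, l'.2), Finset.mem_map_of_mem _ hl, Finset.mem_map_of_mem _ hl', ?_⟩
    change letterOp (e l.1, l.2) * letterOp (e l'.1, l'.2) = relabel e (letterOp l * letterOp l')
    rw [map_mul, relabel_letterOp, relabel_letterOp]
  exact hmap ⟨A, hA, rfl⟩

/-- Orbital sets are covariant under site bijections. [folklore] -/
theorem map_orbSet {Λ' : Type*} [LinearOrder Λ'] [Fintype Λ'] (e : Λ ≃ Λ') (X : Finset Λ) :
    (orbSet X).map (Orb.mapEquiv e).toEmbedding = orbSet (X.map e.toEmbedding) := by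
  ext k
  rw [Finset.mem_map_equiv, mem_orbSet, mem_orbSet, Finset.mem_map_equiv]
  rfl

/-- **Conjugation by the translation shifts supports**: `V A Vᴴ ∈ 𝔄⁺(slab (S+1))` for
`A ∈ 𝔄⁺(slab S)`. [folklore] -/
theorem relabelOp_conj_mem_carEvenSubalgebra_cslab (hf : ∀ x : Λ, coord (f x) = coord x + 1) {S : Finset (ZMod L)}
    {A : Matrix (Finset (Orb Λ)) (Finset (Orb Λ)) ℂ} (hA : A ∈ carEvenSubalgebra (orbSet (cslab coord S))) :
    relabelOp (Orb.mapEquiv f) * A * (relabelOp (Orb.mapEquiv f))ᴴ ∈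
      carEvenSubalgebra (orbSet (cslab coord (S.image fun a => a + 1))) := by
  rw [← relabel_eq_relabelOp_conj, ← map_cslab hf, ← map_orbSet]
  exact relabel_mem_carEvenSubalgebra (Orb.mapEquiv f) hA

/-- **The unique ground state of a translation-invariant gapped Hamiltonian is a translation
eigenvector**: `Vψ = λψ`, `|λ| = 1`, `Vᴴψ = λ⁻¹ψ`. [folklore] -/
theorem exists_relabelOp_mulVec_eq_smul {H : Matrix (Finset (Orb Λ)) (Finset (Orb Λ)) ℂ} {g : ℝ}
    (hgap : H.HasSpectralGap g) (e : Orb Λ ≃ Orb Λ) (hsym : relabelOp e * H = H * relabelOp e)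
    {ψ : Fock (Orb Λ)} (hψ : H.IsGroundStateVector ψ) :
    ∃ lam : ℂ, ‖lam‖ = 1 ∧ relabelOp e *ᵥ ψ = lam • ψ ∧ (relabelOp e)ᴴ *ᵥ ψ = lam⁻¹ • ψ := by
  obtain ⟨c, hc⟩ := hgap.exists_mulVec_eq_smul hsym hψ
  have hψ0 : ψ ≠ 0 := hψ.1
  have hnorm : star (relabelOp e *ᵥ ψ) ⬝ᵥ (relabelOp e *ᵥ ψ) = star ψ ⬝ᵥ ψ := by
    rw [star_mulVec, ← dotProduct_mulVec, conjTranspose_relabelOp_mulVec_mulVec]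
  rw [hc, star_smul, smul_dotProduct, dotProduct_smul, smul_smul, smul_eq_mul] at hnorm
  have hψψ : star ψ ⬝ᵥ ψ ≠ 0 := by
    rw [star_dotProduct_self_eq_eucNorm_sq]
    have : eucNorm ψ ≠ 0 := by
      intro h0
      apply hψ0
      have : (WithLp.toLp 2 ψ : EuclideanSpace ℂ (Finset (Orb Λ))) = 0 := norm_eq_zero.1 h0
      exact (WithLp.toLp_eq_zero (p := 2)).1 this
    exact_mod_cast pow_ne_zero 2 this
  have hcc : star c * c = 1 := mul_right_cancel₀ hψψ (hnorm.trans (one_mul _).symm)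
  have hcn : ‖c‖ = 1 := by
    have h := congrArg (fun z : ℂ => ‖z‖) hcc
    simp only [norm_mul, norm_star, norm_one] at h
    nlinarith [norm_nonneg c]
  have hc0 : c ≠ 0 := fun h => by rw [h, norm_zero] at hcn; exact zero_ne_one hcn
  refine ⟨c, hcn, hc, ?_⟩
  have h2 : (relabelOp e)ᴴ *ᵥ (relabelOp e *ᵥ ψ) = ψ := conjTranspose_relabelOp_mulVec_mulVec e ψ
  rw [hc, mulVec_smul] at h2
  have := congrArg (fun v => c⁻¹ • v) h2
  simp only [smul_smul, inv_mul_cancel₀ hc0, one_smul] at this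
  exact this

/-- **Translation invariance of ground-state expectations**, both ways:
`⟨ψ, V X Vᴴ ψ⟩ = ⟨ψ, X ψ⟩` and `⟨ψ, Vᴴ X V ψ⟩ = ⟨ψ, X ψ⟩`. [folklore] -/
theorem expect_relabelOp_conj {H : Matrix (Finset (Orb Λ)) (Finset (Orb Λ)) ℂ} {g : ℝ}
    (hgap : H.HasSpectralGap g) (e : Orb Λ ≃ Orb Λ) (hsym : relabelOp e * H = H * relabelOp e)
    {ψ : Fock (Orb Λ)} (hψ : H.IsGroundStateVector ψ) (X : Matrix (Finset (Orb Λ)) (Finset (Orb Λ)) ℂ) :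
    star ψ ⬝ᵥ ((relabelOp e * X * (relabelOp e)ᴴ) *ᵥ ψ) = star ψ ⬝ᵥ (X *ᵥ ψ) ∧
      star ψ ⬝ᵥ (((relabelOp e)ᴴ * X * relabelOp e) *ᵥ ψ) = star ψ ⬝ᵥ (X *ᵥ ψ) := by
  obtain ⟨lam, hlam, hV, hVh⟩ := exists_relabelOp_mulVec_eq_smul hgap e hsym hψ
  constructor
  · have h := expect_conjTranspose_mul_mul (U := (relabelOp e)ᴴ) (X := X) hVh (by rw [norm_inv, hlam, inv_one])
    rwa [conjTranspose_conjTranspose] at h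
  · exact expect_conjTranspose_mul_mul (U := relabelOp e) (X := X) hV hlam

end Translation

end Literature.MathematicalPhysics.QuantumLattice

end
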